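import Mathlib
import HarnessLib

/-!
# The moment identity of a finite balanced weighted graph (the linear algebra behind the junction test)

Helper for crux K1 (`TropicalWeilVanishing`, stmt-HodgeConjecture-18478) of route `TropicalWeilObstruction` —
negation-sink work of cell `pub-hodge-tropical` (tropical-1 gen 14); it decides nothing about K1 and nothing
here bears on the Hodge conjecture.

Setting (HOME `certificates/splitrigidity/README.md` §4(c), §11). When a constant-type family of effective
tropical cycles degenerates, the rescaled local limit at a generic point of a codimension-one face `e` is, modulo
the direction of `e`, a FINITE BALANCED WEIGHTED GRAPH WITH ENDS: finitely many vertices at positions `x_a`,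
bounded edges `{s(e'), t(e')}` of weight `w_{e'}` (contributing `w • (x_t − x_s)` to the balance at `s` and the
negative at `t`), and unbounded ends attached at vertices `v(h)` with direction `d_h` and weight `u_h`; every
vertex is balanced. Two consequences, valid over any commutative ring and in any module (so in any ambient
dimension), are what the JUNCTION TEST of §11 imposes on a candidate split-point limit configuration:

* `sum_ends_smul_eq_zero` — the ends balance: `Σ_h u_h • d_h = 0` (the recession fan of a balanced graph is
  balanced; README §4(b));
* `sum_ends_smul_moment_eq_zero` — the MOMENT IDENTITY: for every alternating bilinear `B`,
  `Σ_h u_h • B(x_{v(h)}, d_h) = 0` (pair the balance at `a` with `x_a` and sum: bounded edges cancel in pairs by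
  antisymmetry; README §4(c), condition (II) of §11), and `sum_ends_smul_moment_add_eq` — the moment is
  independent of the origin.

With `B = ∧` on `ℝ²ⁿ/L_e` these say: the weighted end directions of the local limit sum to zero and the weighted
moments `Σ_h W_h (ā_h ∧ n_h)` of the sheet half-spaces vanish — at a trivalent face this is the concurrency of
the averaged planes, at a crossing of two planes the node-resolution coupling. Pure linear algebra; no
definition, no named fact, no sorry.

References (context only; the identities themselves are folklore): G. Mikhalkin, I. Zharkov, *Tropical
eigenwave and intermediate Jacobians*, LN UMI 15 (2014), §4 (balancing); I. Zharkov, *Tropical abelian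
varieties, Weil classes and the Hodge conjecture*, arXiv:2002.02347 (2020), §2.
-/

-- `Summit.HodgeConjecture.HodgeConjecture.…` is the mandated namespace (single-conjunct summit).
set_option linter.dupNamespace false

open scoped BigOperators

namespace Summit.HodgeConjecture.HodgeConjecture.Theorems.TropicalWeilVanishing.Junction

variable {R : Type*} [CommRing R]
variable {M : Type*} [AddCommGroup M] [Module R M]
variable {N : Type*} [AddCommGroup N] [Module R N]
variable {V E H : Type*} [Fintype V] [Fintype E] [Fintype H] [DecidableEq V]

/-- Summing a vertex-indicator over the vertices picks out the one term (bookkeeping). [folklore] -/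
theorem sum_ite_vertex_eq (f : V) (m : M) : (∑ a : V, if f = a then m else 0) = m := by
  rw [Finset.sum_ite_eq]; simp

/-- **The ends of a balanced graph balance** (`Σ_h u_h • d_h = 0`). Hypothesis `hbal a`: at every vertex `a`
the weighted outgoing vectors of the bounded edges at `a` plus the weighted directions of the ends attached at
`a` sum to zero. Summing over all vertices, each bounded edge contributes `w • (x_t − x_s) + w • (x_s − x_t) = 0`.
[folklore] -/
theorem sum_ends_smul_eq_zero (x : V → M) (src tgt : E → V) (w : E → R) (vtx : H → V) (dir : H → M)
    (u : H → R)
    (hbal : ∀ a : V,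
      (∑ e, ((if src e = a then w e • (x (tgt e) - x (src e)) else 0)
          + (if tgt e = a then w e • (x (src e) - x (tgt e)) else 0)))
        + (∑ h, if vtx h = a then u h • dir h else 0) = 0) :
    ∑ h, u h • dir h = 0 := by
  have htot : ∑ a, ((∑ e, ((if src e = a then w e • (x (tgt e) - x (src e)) else 0)
          + (if tgt e = a then w e • (x (src e) - x (tgt e)) else 0)))
        + (∑ h, if vtx h = a then u h • dir h else 0)) = 0 :=
    Finset.sum_eq_zero fun a _ => hbal a
  have hE : ∑ a, ∑ e, ((if src e = a then w e • (x (tgt e) - x (src e)) else 0)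
          + (if tgt e = a then w e • (x (src e) - x (tgt e)) else 0)) = (0 : M) := by
    rw [Finset.sum_comm]
    refine Finset.sum_eq_zero fun e _ => ?_
    rw [Finset.sum_add_distrib, sum_ite_vertex_eq, sum_ite_vertex_eq, ← smul_add]
    have h0 : x (tgt e) - x (src e) + (x (src e) - x (tgt e)) = 0 := by abel
    rw [h0, smul_zero]
  have hH : ∑ a, ∑ h, (if vtx h = a then u h • dir h else 0) = ∑ h, u h • dir h := by
    rw [Finset.sum_comm]
    exact Finset.sum_congr rfl fun h _ => sum_ite_vertex_eq (vtx h) _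
  rw [Finset.sum_add_distrib, hE, hH, zero_add] at htot
  exact htot

/-- **The moment identity.** For every alternating bilinear `B : M × M → N` and every balanced finite weighted
graph with ends (hypothesis as in `sum_ends_smul_eq_zero`): `Σ_h u_h • B(x_{v(h)}, d_h) = 0` — the weighted
moments of the ends about the origin cancel. Proof: apply `B(x_a, ·)` to the balance at `a` and sum over `a`;
a bounded edge `{s,t}` contributes `w • (B(x_s, x_t − x_s) + B(x_t, x_s − x_t)) = w • (B(x_s,x_t) + B(x_t,x_s)) = 0`.
[folklore] -/
theorem sum_ends_smul_moment_eq_zero (B : M →ₗ[R] M →ₗ[R] N) (hB : ∀ m : M, B m m = 0)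
    (x : V → M) (src tgt : E → V) (w : E → R) (vtx : H → V) (dir : H → M) (u : H → R)
    (hbal : ∀ a : V,
      (∑ e, ((if src e = a then w e • (x (tgt e) - x (src e)) else 0)
          + (if tgt e = a then w e • (x (src e) - x (tgt e)) else 0)))
        + (∑ h, if vtx h = a then u h • dir h else 0) = 0) :
    ∑ h, u h • B (x (vtx h)) (dir h) = 0 := by
  -- antisymmetry of an alternating form
  have hanti : ∀ p q : M, B p q + B q p = 0 := by
    intro p q
    have h := hB (p + q)
    simp only [map_add, LinearMap.add_apply, hB, zero_add, add_zero] at h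
    first
      | exact h
      | (rw [add_comm] at h; exact h)
  -- push `B (x a)` through an indicator
  have hite : ∀ (a : V) (c : Prop) [Decidable c] (m : M),
      B (x a) (if c then m else 0) = if c then B (x a) m else 0 := by
    intro a c _ m; split_ifs <;> simp
  -- pair the balance at `a` with `x a` and sum over `a`
  have htot : ∑ a, B (x a) ((∑ e, ((if src e = a then w e • (x (tgt e) - x (src e)) else 0)
          + (if tgt e = a then w e • (x (src e) - x (tgt e)) else 0)))
        + (∑ h, if vtx h = a then u h • dir h else 0)) = 0 :=
    Finset.sum_eq_zero fun a _ => by rw [hbal a, map_zero]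
  have hsplit : ∀ a, B (x a) ((∑ e, ((if src e = a then w e • (x (tgt e) - x (src e)) else 0)
          + (if tgt e = a then w e • (x (src e) - x (tgt e)) else 0)))
        + (∑ h, if vtx h = a then u h • dir h else 0))
      = (∑ e, ((if src e = a then w e • B (x a) (x (tgt e) - x (src e)) else 0)
          + (if tgt e = a then w e • B (x a) (x (src e) - x (tgt e)) else 0)))
        + ∑ h, (if vtx h = a then u h • B (x a) (dir h) else 0) := by
    intro a
    rw [map_add, map_sum, map_sum]
    congr 1
    · refine Finset.sum_congr rfl fun e _ => ?_
      rw [map_add, hite, hite, map_smul, map_smul]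
    · refine Finset.sum_congr rfl fun h _ => ?_
      rw [hite, map_smul]
  simp_rw [hsplit] at htot
  rw [Finset.sum_add_distrib] at htot
  -- the bounded edges cancel
  have hE : ∑ a, ∑ e, ((if src e = a then w e • B (x a) (x (tgt e) - x (src e)) else 0)
          + (if tgt e = a then w e • B (x a) (x (src e) - x (tgt e)) else 0)) = (0 : N) := by
    rw [Finset.sum_comm]
    refine Finset.sum_eq_zero fun e _ => ?_
    rw [Finset.sum_add_distrib]
    have h1 : ∑ a, (if src e = a then w e • B (x a) (x (tgt e) - x (src e)) else 0)
        = w e • B (x (src e)) (x (tgt e) - x (src e)) := by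
      rw [Finset.sum_ite_eq]; simp
    have h2 : ∑ a, (if tgt e = a then w e • B (x a) (x (src e) - x (tgt e)) else 0)
        = w e • B (x (tgt e)) (x (src e) - x (tgt e)) := by
      rw [Finset.sum_ite_eq]; simp
    rw [h1, h2, ← smul_add, map_sub, map_sub, hB, hB]
    have := hanti (x (src e)) (x (tgt e))
    have e1 : B (x (src e)) (x (tgt e)) - 0 + (B (x (tgt e)) (x (src e)) - 0)
        = B (x (src e)) (x (tgt e)) + B (x (tgt e)) (x (src e)) := by abel
    rw [e1, this, smul_zero]
  -- the ends give the moment sum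
  have hH : ∑ a, ∑ h, (if vtx h = a then u h • B (x a) (dir h) else 0) = ∑ h, u h • B (x (vtx h)) (dir h) := by
    rw [Finset.sum_comm]
    refine Finset.sum_congr rfl fun h _ => ?_
    rw [Finset.sum_ite_eq]; simp
  rw [hE, hH, zero_add] at htot
  exact htot

/-- **The moment is origin-independent.** For a balanced finite weighted graph with ends, translating all
positions by `c` changes `Σ_h u_h • B(x_{v(h)}, d_h)` by `B(c, Σ_h u_h • d_h) = 0`. (So the moment condition of
the junction test may be evaluated about any origin, component by component.) [folklore] -/
theorem sum_ends_smul_moment_add_eq (B : M →ₗ[R] M →ₗ[R] N)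
    (x : V → M) (src tgt : E → V) (w : E → R) (vtx : H → V) (dir : H → M) (u : H → R)
    (hbal : ∀ a : V,
      (∑ e, ((if src e = a then w e • (x (tgt e) - x (src e)) else 0)
          + (if tgt e = a then w e • (x (src e) - x (tgt e)) else 0)))
        + (∑ h, if vtx h = a then u h • dir h else 0) = 0)
    (c : M) :
    ∑ h, u h • B (x (vtx h) + c) (dir h) = ∑ h, u h • B (x (vtx h)) (dir h) := by
  have hends := sum_ends_smul_eq_zero x src tgt w vtx dir u hbal
  have hc : ∑ h, u h • B c (dir h) = 0 := by
    have : ∑ h, u h • B c (dir h) = B c (∑ h, u h • dir h) := by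
      rw [map_sum]
      exact Finset.sum_congr rfl fun h _ => by rw [map_smul]
    rw [this, hends, map_zero]
  calc ∑ h, u h • B (x (vtx h) + c) (dir h)
      = ∑ h, (u h • B (x (vtx h)) (dir h) + u h • B c (dir h)) := by
        refine Finset.sum_congr rfl fun h _ => ?_
        rw [map_add, LinearMap.add_apply, smul_add]
    _ = ∑ h, u h • B (x (vtx h)) (dir h) + ∑ h, u h • B c (dir h) := Finset.sum_add_distrib
    _ = ∑ h, u h • B (x (vtx h)) (dir h) := by rw [hc, add_zero]

/-! ### Appended: concurrency at a trivalent face (README §4(c), last step)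

Literature note for the whole file (found after the first part landed): `sum_ends_smul_moment_eq_zero` is the
TROPICAL MENELAUS THEOREM / moment condition for planar tropical curves (G. Mikhalkin, *Quantum indices and
refined enumeration of real plane curves*, Acta Math. 219 (2017); S. Yoshitomi) in its any-dimension,
module-valued form (N. Kalinin, *A guide to tropical modifications*, arXiv:1509.03443, Prop. 2.16, for curves
in `𝕋³`, same proof). Its use in the cell is on the rescaled local limit of a degenerating family of
tropical cycles at a codimension-one face (HOME `certificates/splitrigidity/README.md` §11). -/

section Concurrency

variable {K : Type*} [Field K] {P : Type*} [AddCommGroup P] [Module K P]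

/-- **Three balanced ends with zero moment are concurrent.** Let `B` be an alternating bilinear form on a
`K`-vector space, and let three ends `a_i + K·n_i` with weights `w_i` satisfy the balancing
`w₁n₁ + w₂n₂ + w₃n₃ = 0` and the moment identity `w₁B(a₁,n₁) + w₂B(a₂,n₂) + w₃B(a₃,n₃) = 0`
(`sum_ends_smul_moment_eq_zero`). If the first two lines pass through a point `q` and `w₃ ≠ 0`, then
`B(a₃ − q, n₃) = 0` — for the area form on a plane this says `q` lies on the third line as well: the three
sheet-averaged planes at a trivalent face of a degenerating family stay CONCURRENT (HOME
`certificates/splitrigidity/README.md` §4(c)). Proof: the moment is origin-independent because the ends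
balance, and about `q` the first two moments vanish. [folklore] -/
theorem form_sub_eq_zero_of_moment (B : P →ₗ[K] P →ₗ[K] K) (hB : ∀ m : P, B m m = 0)
    (a₁ a₂ a₃ n₁ n₂ n₃ q : P) (w₁ w₂ w₃ : K) (hw₃ : w₃ ≠ 0)
    (hbal : w₁ • n₁ + w₂ • n₂ + w₃ • n₃ = 0)
    (hmom : w₁ * B a₁ n₁ + w₂ * B a₂ n₂ + w₃ * B a₃ n₃ = 0)
    (h₁ : ∃ t : K, a₁ - q = t • n₁) (h₂ : ∃ t : K, a₂ - q = t • n₂) :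
    B (a₃ - q) n₃ = 0 := by
  obtain ⟨t₁, ht₁⟩ := h₁
  obtain ⟨t₂, ht₂⟩ := h₂
  -- moments about `q`
  have e₁ : B (a₁ - q) n₁ = 0 := by rw [ht₁, map_smul, LinearMap.smul_apply, hB, smul_zero]
  have e₂ : B (a₂ - q) n₂ = 0 := by rw [ht₂, map_smul, LinearMap.smul_apply, hB, smul_zero]
  -- origin independence: Σ w_i B(a_i − q, n_i) = Σ w_i B(a_i, n_i) − B q (Σ w_i n_i) = 0
  have hq : B q (w₁ • n₁ + w₂ • n₂ + w₃ • n₃) = 0 := by rw [hbal, map_zero]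
  have key : w₁ * B (a₁ - q) n₁ + w₂ * B (a₂ - q) n₂ + w₃ * B (a₃ - q) n₃ = 0 := by
    have expand : w₁ * B (a₁ - q) n₁ + w₂ * B (a₂ - q) n₂ + w₃ * B (a₃ - q) n₃
        = (w₁ * B a₁ n₁ + w₂ * B a₂ n₂ + w₃ * B a₃ n₃) - B q (w₁ • n₁ + w₂ • n₂ + w₃ • n₃) := by
      simp only [map_sub, LinearMap.sub_apply, map_add, map_smul, smul_eq_mul]
      ring
    rw [expand, hmom, hq, sub_zero]
  rw [e₁, e₂, mul_zero, mul_zero, zero_add, zero_add] at key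
  exact (mul_eq_zero.mp key).resolve_left hw₃

/-- **In the plane: zero area against a non-zero vector means parallel.** For the area form
`det(u, v) = u₀v₁ − u₁v₀` on `K²` and `n ≠ 0`, `det(v, n) = 0` iff `v ∈ K·n`; so in
`form_sub_eq_zero_of_moment` with `B = det` the conclusion reads `q ∈ a₃ + K·n₃`. [folklore] -/
theorem exists_smul_of_det_eq_zero (v n : Fin 2 → K) (hn : n ≠ 0)
    (h : v 0 * n 1 - v 1 * n 0 = 0) : ∃ t : K, v = t • n := by
  by_cases h0 : n 0 = 0
  · have h1 : n 1 ≠ 0 := by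
      intro h1; apply hn; funext i; fin_cases i <;> simp [h0, h1]
    have hv0 : v 0 = 0 := by
      have : v 0 * n 1 = 0 := by rw [h0, mul_zero, sub_zero] at h; exact h
      exact (mul_eq_zero.mp this).resolve_right h1
    refine ⟨v 1 / n 1, ?_⟩
    funext i; fin_cases i
    · simp [hv0, h0]
    · simp [div_mul_cancel₀ _ h1]
  · refine ⟨v 0 / n 0, ?_⟩
    funext i; fin_cases i
    · simp [div_mul_cancel₀ _ h0]
    · simp only [Fin.mk_one, Fin.isValue, Pi.smul_apply, smul_eq_mul]
      rw [div_mul_eq_mul_div, eq_div_iff h0]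
      exact (sub_eq_zero.mp h).symm

end Concurrency

/-! ### Appended: which pairs of cells can tear — a Weil-active cell never shares a codimension-one
face with a complex cell when `n ≥ 3` (README §11, Remark 'the n = 2 tearing pair does not lift') -/

section TearingPairs

variable {K : Type*} [Field K] {W : Type*} [AddCommGroup W] [Module K W] [FiniteDimensional K W]

/-- **Totally real against complex: the intersection is at most half.** Let `J` be an injective linear
operator, `P` a subspace with `P ∩ J P = 0` ("totally real" — for the Weil structure `J` on `ℝ²ⁿ` and a
rank-`n` cell plane this is exactly `η_P ≠ 0`, i.e. the cell is Weil-ACTIVE) and `P'` a `J`-stable subspace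
(a "complex" cell plane, e.g. the complex-line fillers of the n = 2 limit `Z₀`). Then
`2 · dim(P ∩ P') ≤ dim P'`: with `V = P ∩ P'`, `V ∩ JV ⊆ P ∩ JP = 0` and `V + JV ⊆ P'`. Consequence
(HOME `certificates/splitrigidity/README.md` §11): two rank-`n` cells of these kinds meet in dimension
`≤ n/2`, which is `< n − 1` as soon as `n ≥ 3` — the twelve tears `germ torus × complex line` of the n = 2
smoothing (where `n − 1 = n/2 = 1`) have no literal analogue on the tropical Weil `2n`-folds, `n ≥ 3`:
there a Weil-active cell can only tear against a non-complex cell. [folklore] -/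
theorem two_mul_finrank_inf_le_of_totallyReal_of_complex (J : W →ₗ[K] W) (hJ : Function.Injective J)
    (P P' : Submodule K W) (hP : P ⊓ P.map J = ⊥) (hP' : P'.map J ≤ P') :
    2 * Module.finrank K ↥(P ⊓ P') ≤ Module.finrank K ↥P' := by
  set V : Submodule K W := P ⊓ P' with hV
  have hVJ : Module.finrank K ↥(V.map J) = Module.finrank K ↥V :=
    (Submodule.equivMapOfInjective J hJ V).finrank_eq.symm
  have hinf : V ⊓ V.map J = ⊥ := by
    rw [eq_bot_iff, ← hP]
    exact inf_le_inf inf_le_left (Submodule.map_mono inf_le_left)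
  have hsup : V ⊔ V.map J ≤ P' :=
    sup_le inf_le_right ((Submodule.map_mono inf_le_right).trans hP')
  have hdim := Submodule.finrank_sup_add_finrank_inf_eq V (V.map J)
  rw [hinf, finrank_bot, add_zero, hVJ] at hdim
  have hle := Submodule.finrank_mono hsup
  omega

end TearingPairs

end Summit.HodgeConjecture.HodgeConjecture.Theorems.TropicalWeilVanishing.Junction
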